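import Summits.ResolutionOfSingularities.ResolutionOfSingularities.Theorems.EquisingularLiftEquisingularLiftNatAOddVertices
import Summits.ResolutionOfSingularities.ResolutionOfSingularities.Theorems.EquisingularLiftEquisingularLiftNatNoLevelCubicX
import HarnessLib

/-!
# [OURS] NO LEVEL AT A VERTEX OF A PROJECTIVE SURFACE: the affine «no blow-up depth» statements transported to the point of `V₊(F)` over a coordinate vertex,
# and ★ a prime surface `V₊(F) ⊆ ℙ³` whose vertex chart is `y₂² + y₂A + B` (`A ∈ (y)²`, `B ∈ (y)⁴`) has a CLOSED point of NO finite depth in any blow-up tower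
# (cruxes `Theses.EquisingularLift.EquisingularLiftNat` / `…NatThree` / `EquisingularLift`, stmt-ResolutionOfSingularities-20038 / -20148 / -15660)

[OURS · leafhand-res-equisingularlift-12 g1, 2026-09-01; cell `pub/decomp-res`] AI-produced, weaker than expert review; NOT a statement of any manuscript;
nothing here proves resolution of singularities in positive characteristic.  DEF-FREE helper; no `sorry`; standard axioms; ZERO named hypotheses.

* ★★ `OneStep.towerLevel_iff_of_openImmersion` — `D n X y₀ ↔ D n Y (ψ y₀)` along an open immersion (closed points; the iff form of ✓ `towerLevel_of_openImmersion`);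
* ★★ `towerLevel_none_vertex_of_origin` — ✓ `towerLevel_vertex_of_origin` (leafhand-12 g0) with «no level» as payload: if the origin of `Spec K[y]/(Φ + Ψ)`
  (`F(x_c := 1) = Φ + Ψ`, radical) has no `D`-level then neither has the point of `V₊(F)` over `P_c`;
* ★★★ `exists_point_towerLevel_none_of_vertex_sq_add_X_mul` — `F` a PRIME form in `K[x₀,…,x₃]` with `F(x_c := 1) = y₂² + (y₂A + B)`, `A ∈ (y)²`, `B ∈ (y)⁴`:
  the vertex point is a closed point of `V₊(F)` with NO `D`-level in any blow-up tower `D` (✓ `towerLevel_none_origin_sq_add_X_mul`).  NON-VACUOUS with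
  arbitrary tails: e.g. the quartic `x₀⁴ + x₁⁴ + x₂²x₃²` (two `Ẽ₇` points, finitely many singular points) — so hypothesis #2 «finite non-regular locus» of
  `stub_elnat_three_isolated…` does NOT imply finite depth, and ✓ `isoHypPoint_of_towerPoints` cannot reach such surfaces.

Closes no registered stub.

References: [Hartshorne1977, II Prop. 5.9]; [StacksProject, Tags 0804, 080E]; [GortzWedhorn2020, (13.19)]; [Lipman1969, §24]; through the cited tree files.
-/

set_option linter.dupNamespace false -- mandated namespace `Summit.<Summit>.<Problem>` of this single-conjunct summit

noncomputable section

open CategoryTheory CategoryTheory.Limits AlgebraicGeometry TopologicalSpace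
open Literature.AlgebraicGeometry.Resolution Literature.AlgebraicGeometry.Motives
open AlgebraicGeometry.Scheme.IdealSheafData
open MvPolynomial HomogeneousLocalization
open Literature.AlgebraicGeometry.Motives.SmoothHypersurface Literature.AlgebraicGeometry.Motives.ProjectiveSpace
open Summit.ResolutionOfSingularities.ResolutionOfSingularities.Cruxes.EquisingularLift.StrataSplit

namespace Summit.ResolutionOfSingularities.ResolutionOfSingularities.Cruxes.EquisingularLiftNat.Sections

/-- ★★ **TOWER LEVELS ALONG OPEN IMMERSIONS, IFF FORM** (closed points): `ψ : X → Y` an open immersion, `ψ y₀ = x`, then `D n X y₀ ↔ D n Y x`.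
[OURS] [cite: GortzWedhorn2020, (13.19)] -/
theorem OneStep.towerLevel_iff_of_openImmersion (D : ℕ → ∀ Γ : Scheme.{0}, Γ → Prop)
    (hD0 : ∀ (Γ : Scheme.{0}) (y : Γ), IsClosed (({y} : Set Γ)) →
      (D 0 Γ y ↔ ∀ (hy : IsClosed (({y} : Set Γ))) (Z : Scheme.{0}) (τ : Z ⟶ Γ), IsBlowup τ (vanishingIdeal ⟨{y}, hy⟩) →
        ∀ z : Z, τ z = y → IsRegularLocalRing (Z.presheaf.stalk z)))
    (hDsucc : ∀ (d : ℕ) (Γ : Scheme.{0}) (y : Γ), IsClosed (({y} : Set Γ)) →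
      (D (d + 1) Γ y ↔ ∀ (hy : IsClosed (({y} : Set Γ))) (Z : Scheme.{0}) (τ : Z ⟶ Γ), IsBlowup τ (vanishingIdeal ⟨{y}, hy⟩) →
        ∃ S' : Finset Z, (∀ z : Z, τ z = y → z ∉ S' → IsRegularLocalRing (Z.presheaf.stalk z)) ∧
          ∀ z ∈ S', τ z = y ∧ IsClosed (({z} : Set Z)) ∧ ∃ d' ≤ d, D d' Z z))
    (n : ℕ) {X₀ Y : Scheme.{0}} (ψ : X₀ ⟶ Y) [IsOpenImmersion ψ] {y₀ : X₀} {x : Y} (hψx : ψ y₀ = x)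
    (hy₀cl : IsClosed ({y₀} : Set X₀)) (hxcl : IsClosed ({x} : Set Y)) : D n X₀ y₀ ↔ D n Y x := by
  have hloc := tower_loc D hD0 hDsucc n
  let U : Y.Opens := ψ.opensRange
  let e := ψ.isoOpensRange
  have hψU : ∀ v, U.ι (e.hom v) = ψ v := fun v => by
    rw [← Scheme.Hom.comp_apply, Scheme.Hom.isoOpensRange_hom_ι]
  have hxU : x ∈ U := ⟨y₀, hψx⟩
  have hucl : IsClosed ({e.hom y₀} : Set (U : Scheme.{0})) :=
    PointChain.isClosed_singleton_of_injective U.ι U.ι.isOpenEmbedding.injective (by rw [hψU, hψx]; exact hxcl)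
  have he' : e.inv (e.hom y₀) = y₀ := by
    change (e.hom ≫ e.inv) y₀ = y₀
    rw [e.hom_inv_id]
    rfl
  haveI : IsIso (e.inv ∣_ (⊤ : X₀.Opens)) := inferInstance
  have h1 : D n X₀ y₀ ↔ D n (U : Scheme.{0}) (e.hom y₀) :=
    hloc _ _ e.inv ⊤ inferInstance y₀ (Set.mem_univ _) hy₀cl (e.hom y₀) he' hucl
  haveI := PointChain.isIso_ι_morphismRestrict_self U
  have h2 : D n Y x ↔ D n (U : Scheme.{0}) (e.hom y₀) :=
    hloc _ _ U.ι U inferInstance x hxU hxcl (e.hom y₀) ((hψU y₀).trans hψx) hucl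
  exact h1.trans h2.symm

/-- ★★ **NO LEVEL AT A VERTEX FROM AN AFFINE «NO LEVEL» STATEMENT** (proof of ✓ `towerLevel_vertex_of_origin` verbatim, payload reversed along
✓ `OneStep.towerLevel_iff_of_openImmersion`). [OURS] [cite: Hartshorne1977, II Prop. 5.9] [cite: StacksProject, Tag 0804] -/
theorem towerLevel_none_vertex_of_origin (K : Type) [Field K] {m : ℕ} (D : ℕ → ∀ Γ : Scheme.{0}, Γ → Prop)
    (hD0 : ∀ (Γ : Scheme.{0}) (y : Γ), IsClosed (({y} : Set Γ)) →
      (D 0 Γ y ↔ ∀ (hy : IsClosed (({y} : Set Γ))) (Z : Scheme.{0}) (τ : Z ⟶ Γ), IsBlowup τ (vanishingIdeal ⟨{y}, hy⟩) →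
        ∀ z : Z, τ z = y → IsRegularLocalRing (Z.presheaf.stalk z)))
    (hDsucc : ∀ (d : ℕ) (Γ : Scheme.{0}) (y : Γ), IsClosed (({y} : Set Γ)) →
      (D (d + 1) Γ y ↔ ∀ (hy : IsClosed (({y} : Set Γ))) (Z : Scheme.{0}) (τ : Z ⟶ Γ), IsBlowup τ (vanishingIdeal ⟨{y}, hy⟩) →
        ∃ S' : Finset Z, (∀ z : Z, τ z = y → z ∉ S' → IsRegularLocalRing (Z.presheaf.stalk z)) ∧
          ∀ z ∈ S', τ z = y ∧ IsClosed (({z} : Set Z)) ∧ ∃ d' ≤ d, D d' Z z))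
    (F : MvPolynomial (Fin (m + 2 + 1)) K) {d₀ : ℕ} (hF : F.IsHomogeneous d₀) (hd : 0 < d₀)
    (c : Fin (m + 2 + 1)) (Φ Ψ : MvPolynomial (Fin (m + 2)) K) {μ : ℕ} (hμ : 1 ≤ μ) (hΦ : Φ.IsHomogeneous μ)
    (hΨ : Ψ ∈ Ideal.span (Set.range (X : Fin (m + 2) → MvPolynomial (Fin (m + 2)) K)) ^ (μ + 1))
    (hdeh : ProjectiveSpace.dehomogenize K c F = Φ + Ψ) (hrad : (Ideal.span {Φ + Ψ}).radical = Ideal.span {Φ + Ψ})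
    (horigin : ∀ y : Spec (CommRingCat.of (MvPolynomial (Fin (m + 2)) K ⧸ Ideal.span {Φ + Ψ})),
      y.asIdeal = Ideal.map (Ideal.Quotient.mk (Ideal.span {Φ + Ψ})) (Ideal.span (Set.range (X : Fin (m + 2) → MvPolynomial (Fin (m + 2)) K))) →
      ∀ n, ¬ D n (Spec (CommRingCat.of (MvPolynomial (Fin (m + 2)) K ⧸ Ideal.span {Φ + Ψ}))) y) :
    letI := MvPolynomial.gradedAlgebra (σ := Fin (m + 2 + 1)) (R := K)
    ∃ (x₀ : ↥(hypersurface F).left) (_ : IsClosed ({x₀} : Set ↥(hypersurface F).left)),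
      (∀ a : Fin (m + 2 + 1), a ≠ c → (X a : MvPolynomial (Fin (m + 2 + 1)) K) ∈ ((hypersurfaceι F).left x₀).asHomogeneousIdeal) ∧
      ∀ n, ¬ D n (hypersurface F).left x₀ := by
  letI := MvPolynomial.gradedAlgebra (σ := Fin (m + 2 + 1)) (R := K)
  letI := MvPolynomial.gradedAlgebra (σ := Fin (0 + 1)) (R := K)
  letI := ProjBaseChange.algebraBase (R := K) (homogeneousSubmodule (Fin (m + 2 + 1)) K)
    (Submonoid.powers (X c : MvPolynomial (Fin (m + 2 + 1)) K))
  classical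
  -- the kill map of the vertex `P_c`
  have he : Function.Injective (fun _ : Fin 1 => c) := Function.injective_of_subsingleton _
  obtain ⟨fk, hfk', hfkC, hfke, hfk0⟩ := LinearCentre.exists_kill (R := K) (fun _ : Fin 1 => c) he
  have hfke' : ∀ j : Fin 1, fk (X c) = X j := fun j => hfke j
  have hfk0' : ∀ i : Fin (m + 2 + 1), i ≠ c → fk (X i) = 0 := fun i hi => hfk0 i (fun ⟨_, hj⟩ => hi hj.symm)
  -- the vertex point
  obtain ⟨x₀, hx₀cl, hx₀cl', hsupp, hx₀X, hΛ, hcomap⟩ :=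
    exists_vertexPoint K F hF c ⟨μ, Φ, Ψ, hμ, hΦ, hΨ, hdeh⟩ fk hfk' hfkC hfke' hfk0'
  refine ⟨x₀, hx₀cl', hx₀X, ?_⟩
  -- the chart `ψ = Spec θ ≫ chart F c`
  obtain ⟨θ, hθ⟩ := HypersurfaceSpecimen.exists_chartQuotEquiv F hF c (Φ + Ψ) hdeh hrad
  let ψ : Spec (CommRingCat.of (MvPolynomial (Fin (m + 2)) K ⧸ Ideal.span {Φ + Ψ})) ⟶ (hypersurface F).left :=
    Spec.map θ.toCommRingCatIso.hom ≫ (chart F c hF hd).left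
  haveI : IsOpenImmersion (Spec.map θ.toCommRingCatIso.hom) := IsOpenImmersion.of_isIso _
  haveI : @IsOpenImmersion (Spec (CommRingCat.of (ChartRing F c hF))) _ (chart F c hF hd).left :=
    isOpenImmersion_chart_left F c hF hd
  haveI : IsOpenImmersion ψ := IsOpenImmersion.comp _ _
  -- the origin and its image
  let y₀ : Spec (CommRingCat.of (MvPolynomial (Fin (m + 2)) K ⧸ Ideal.span {Φ + Ψ})) :=
    ⟨Ideal.map (Ideal.Quotient.mk (Ideal.span {Φ + Ψ})) (Ideal.span (Set.range (X : Fin (m + 2) → MvPolynomial (Fin (m + 2)) K))),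
      (OneStep.isMaximal_map_mk_span_range_X K Φ Ψ hμ hΦ hΨ).isPrime⟩
  have hy₀ : y₀.asIdeal = Ideal.map (Ideal.Quotient.mk (Ideal.span {Φ + Ψ}))
      (Ideal.span (Set.range (X : Fin (m + 2) → MvPolynomial (Fin (m + 2)) K))) := rfl
  -- the vertex ideal pulled back to the chart is the origin ideal of `ChartRing F c`
  have hchart := HypersurfaceSpecimen.comap_chart_eq_ofIdealTop K F hF hd (fun _ : Fin 1 => c) he fk hfk' hfkC hfke hfk0 c
  -- the origin ideal of `ChartRing F c` goes into the origin ideal of `K[y]/(f)` under `θ`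
  have hI₀ : ∀ q ∈ Ideal.span (Set.range fun a : {a : Fin (m + 2 + 1) // a ∉ Set.range (fun _ : Fin 1 => c)} => tautVec F c hF a.1),
      θ q ∈ y₀.asIdeal := by
    intro q hq
    have hle : Ideal.span (Set.range fun a : {a : Fin (m + 2 + 1) // a ∉ Set.range (fun _ : Fin 1 => c)} => tautVec F c hF a.1) ≤
        y₀.asIdeal.comap θ.toRingHom := by
      rw [Ideal.span_le]
      rintro _ ⟨⟨a, ha⟩, rfl⟩
      obtain ⟨j, hj⟩ : ∃ j : Fin (m + 2), c.succAbove j = a := Fin.exists_succAbove_eq (fun h => ha ⟨0, h.symm⟩)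
      rw [SetLike.mem_coe, Ideal.mem_comap]
      change θ (tautVec F c hF a) ∈ y₀.asIdeal
      rw [← hj, hθ j, hy₀]
      exact Ideal.mem_map_of_mem _ (Ideal.subset_span ⟨j, rfl⟩)
    exact hle hq
  have hψx : ψ y₀ = x₀ := by
    -- the point `p₀ = Spec θ (y₀)` of the chart lies on the pulled-back vertex ideal
    have hsurj : Function.Surjective (Scheme.ΓSpecIso (CommRingCat.of (ChartRing F c hF))).inv :=
      (ConcreteCategory.bijective_of_isIso (C := CommRingCat) (Scheme.ΓSpecIso (CommRingCat.of (ChartRing F c hF))).inv).2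
    have hinj : Function.Injective (Scheme.ΓSpecIso (CommRingCat.of (ChartRing F c hF))).inv :=
      (ConcreteCategory.bijective_of_isIso (C := CommRingCat) (Scheme.ΓSpecIso (CommRingCat.of (ChartRing F c hF))).inv).1
    -- the chart morphism with source typed as `Spec (ChartRing F c)`
    have hchart' : Scheme.IdealSheafData.comap (X := Spec (CommRingCat.of (ChartRing F c hF)))
        (((Proj.map fk hfk').ker.comap (hypersurfaceι F).left)) (chart F c hF hd).left =
        ofIdealTop ((Ideal.span (Set.range fun a : {a : Fin (m + 2 + 1) // a ∉ Set.range (fun _ : Fin 1 => c)} => tautVec F c hF a.1)).map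
          (Scheme.ΓSpecIso (CommRingCat.of (ChartRing F c hF))).inv.hom) := hchart
    have hp : Spec.map θ.toCommRingCatIso.hom y₀ ∈
        ((Scheme.IdealSheafData.comap (X := Spec (CommRingCat.of (ChartRing F c hF)))
          (((Proj.map fk hfk').ker.comap (hypersurfaceι F).left)) (chart F c hF hd).left).support :
            Set (Spec (CommRingCat.of (ChartRing F c hF)))) := by
      rw [hchart', Scheme.IdealSheafData.coe_support_ofIdealTop, Spec_zeroLocus, Spec.map_apply]
      refine (PrimeSpectrum.mem_zeroLocus _ _).mpr ?_
      intro r hr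
      obtain ⟨r', hr', hrr'⟩ := (Ideal.mem_map_iff_of_surjective _ hsurj).mp hr
      have hr'' : r = r' := hinj hrr'.symm
      subst hr''
      rw [SetLike.mem_coe, PrimeSpectrum.comap_asIdeal, Ideal.mem_comap]
      exact hI₀ r hr'
    rw [Scheme.IdealSheafData.support_comap] at hp
    change (chart F c hF hd).left (Spec.map θ.toCommRingCatIso.hom y₀) ∈
      ((((Proj.map fk hfk').ker.comap (hypersurfaceι F).left)).support : Set ↥(hypersurface F).left) at hp
    rw [hcomap, Scheme.IdealSheafData.coe_support_vanishingIdeal] at hp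
    exact hp
  have hy₀cl : IsClosed ({y₀} : Set (Spec (CommRingCat.of (MvPolynomial (Fin (m + 2)) K ⧸ Ideal.span {Φ + Ψ})))) :=
    (PrimeSpectrum.isClosed_singleton_iff_isMaximal y₀).mpr (OneStep.isMaximal_map_mk_span_range_X K Φ Ψ hμ hΦ hΨ)
  intro n hn
  exact horigin y₀ hy₀ n ((OneStep.towerLevel_iff_of_openImmersion D hD0 hDsucc n ψ hψx hy₀cl hx₀cl').mpr hn)


/-- ★★★ **A PRIME SURFACE WITH A VERTEX CHART `y₂² + (y₂A + B)`, `A ∈ (y)²`, `B ∈ (y)⁴`, HAS A CLOSED POINT OF NO FINITE DEPTH** in any blow-up tower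
(every field): the point of `V₊(F)` over the vertex `P_c`. [OURS] [cite: Hartshorne1977, II Prop. 5.9] [cite: StacksProject, Tag 0804] [cite: Lipman1969, §24] -/
theorem exists_point_towerLevel_none_of_vertex_sq_add_X_mul (K : Type) [Field K] (D : ℕ → ∀ Γ : Scheme.{0}, Γ → Prop)
    (hD0 : ∀ (Γ : Scheme.{0}) (y : Γ), IsClosed (({y} : Set Γ)) →
      (D 0 Γ y ↔ ∀ (hy : IsClosed (({y} : Set Γ))) (Z : Scheme.{0}) (τ : Z ⟶ Γ), IsBlowup τ (vanishingIdeal ⟨{y}, hy⟩) →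
        ∀ z : Z, τ z = y → IsRegularLocalRing (Z.presheaf.stalk z)))
    (hDsucc : ∀ (d : ℕ) (Γ : Scheme.{0}) (y : Γ), IsClosed (({y} : Set Γ)) →
      (D (d + 1) Γ y ↔ ∀ (hy : IsClosed (({y} : Set Γ))) (Z : Scheme.{0}) (τ : Z ⟶ Γ), IsBlowup τ (vanishingIdeal ⟨{y}, hy⟩) →
        ∃ S' : Finset Z, (∀ z : Z, τ z = y → z ∉ S' → IsRegularLocalRing (Z.presheaf.stalk z)) ∧
          ∀ z ∈ S', τ z = y ∧ IsClosed (({z} : Set Z)) ∧ ∃ d' ≤ d, D d' Z z))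
    (F : MvPolynomial (Fin (1 + 2 + 1)) K) {d₀ : ℕ} (hF : F.IsHomogeneous d₀) (hFp : Prime F) (c : Fin (1 + 2 + 1))
    (A B : MvPolynomial (Fin 3) K) (hA : A ∈ Ideal.span (Set.range (X : Fin 3 → MvPolynomial (Fin 3) K)) ^ 2)
    (hB : B ∈ Ideal.span (Set.range (X : Fin 3 → MvPolynomial (Fin 3) K)) ^ 4)
    (hdeh : ProjectiveSpace.dehomogenize K c F = (X 2 ^ 2 : MvPolynomial (Fin 3) K) + (X 2 * A + B)) :
    letI := MvPolynomial.gradedAlgebra (σ := Fin (1 + 2 + 1)) (R := K)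
    ∃ (x₀ : ↥(hypersurface F).left) (_ : IsClosed ({x₀} : Set ↥(hypersurface F).left)),
      (∀ a : Fin (1 + 2 + 1), a ≠ c → (X a : MvPolynomial (Fin (1 + 2 + 1)) K) ∈ ((hypersurfaceι F).left x₀).asHomogeneousIdeal) ∧
      ∀ n, ¬ D n (hypersurface F).left x₀ := by
  have hd : 0 < d₀ := ConeN.pos_of_prime_of_isHomogeneous K F hF hFp
  have hΦ : (X 2 ^ 2 : MvPolynomial (Fin 3) K).IsHomogeneous 2 := isHomogeneous_X_pow (2 : Fin 3) 2
  have hX2I : (X 2 : MvPolynomial (Fin 3) K) ∈ Ideal.span (Set.range (X : Fin 3 → MvPolynomial (Fin 3) K)) :=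
    Ideal.subset_span (Set.mem_range_self (2 : Fin 3))
  have hΨ : (X 2 * A + B : MvPolynomial (Fin 3) K) ∈ Ideal.span (Set.range (X : Fin 3 → MvPolynomial (Fin 3) K)) ^ (2 + 1) := by
    refine Ideal.add_mem _ ?_ (Ideal.pow_le_pow_right (by norm_num) hB)
    rw [pow_succ']
    exact Ideal.mul_mem_mul hX2I hA
  have hrad := OrdPointAt.radical_span_dehomogenize_eq K F c hF hFp (X 2 ^ 2) _ hΦ (by norm_num) hΨ hdeh
  exact towerLevel_none_vertex_of_origin K D hD0 hDsucc F hF hd c (X 2 ^ 2) (X 2 * A + B) (by norm_num) hΦ hΨ hdeh hrad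
    (fun y hy n => OneStep.towerLevel_none_origin_sq_add_X_mul K D hD0 hDsucc A B hA hB y hy n)

end Summit.ResolutionOfSingularities.ResolutionOfSingularities.Cruxes.EquisingularLiftNat.Sections

end
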